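import Literature.Topology.FourManifolds.FishtailSection
import Literature.Topology.FourManifolds.GompfTubeStraightening
import Literature.Topology.FourManifolds.FishtailZoneNorth
import HarnessLib

/-!
# The tube about Gompf's disc over the flat annulus of the section surface

Infrastructure for the explicit fishtail neighbourhood (R. Gompf, *More Cappell–Shaneson spheres
are standard*, Algebr. Geom. Topol. 10 (2010), proof of Thm 2.1 (`F′`) and Lemma 2.2; the named
fact `Literature.Topology.FourManifolds.gompf2010_framedTwist`). Over the annulus of the
`(n, s)`-torus away from the north cap chart, the disc `D` is the graph `{y = 0, ℓ = σ₀(n, s)}`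
of the *real* far section `σ₀ = sigmaFar` (`FishtailSection.lean`) and its tube is vertical:
`(n, s, a, b) ↦ ((n - ℓ, λ a, ℓ), s)`, `ℓ = σ₀(eⁱⁿ, s) - λ b`, read in `T³ × (base)` through
`expT` and in the mapping torus through `mtPt`.

* `Literature.Topology.FourManifolds.midReal`, `Literature.Topology.FourManifolds.midTube` — the
  tube in real form and in `T³ × ℝ`; smoothness where `σ₀` is smooth (`contDiffAt_midReal`),
  injectivity modulo `2π` in `n` (`midTube_inj`);
* `Literature.Topology.FourManifolds.isLocalDiffeomorphAt_midReal`,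
  `Literature.Topology.FourManifolds.isLocalDiffeomorphAt_mtPt_midTube` — local diffeomorphism
  (graph of a shear, `isLocalDiffeomorphAt_graph`, then `northAssemble` and `mtCoord`);
* `Literature.Topology.FourManifolds.tubeShear_midT3` — **equivariance under the tube shear**:
  `tubeShear (midT3 n s a b) = midT3 n (s + 1) a b` for `s ≤ 3/4 - δ`, `3/4 + δ ≤ s + 1` — the seam
  condition that makes the tube descend to the mapping torus of `tubeShear`.

Everything is proved; no named facts.

## References

* R. E. Gompf, *More Cappell–Shaneson spheres are standard*, Algebr. Geom. Topol. 10 (2010)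
  1665–1681, proof of Thm 2.1 (`F`, `F′`) and Lemma 2.2. [GompfAGT2010]
-/

noncomputable section

open scoped Real ContDiff Topology Manifold
open Set Function Filter Complex

namespace Literature.Topology.FourManifolds

local notation "𝔼" n => EuclideanSpace ℝ (Fin n)
local notation "𝓣" =>
  (ModelWithCorners.prod (𝓡 1) (ModelWithCorners.prod (𝓡 1) (𝓡 1)))

section Mid

variable (c δ lam : ℝ)

/-- The fibre angle of the tube point: `ℓ = σ₀(eⁱⁿ, s) - λ b`. [folklore] -/
def midEll (n s b : ℝ) : ℝ := sigmaFar c δ (Circle.exp n) s - lam * b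

/-- **The tube over the flat annulus in real form**: `(n, s, a, b) ↦ ((n - ℓ, λ a, ℓ), s)`. [folklore] -/
def midReal (q : ℝ × ℝ × ℝ × ℝ) : (𝔼 3) × ℝ :=
  (WithLp.toLp 2 ![q.1 - midEll c δ lam q.1 q.2.1 q.2.2.2, lam * q.2.2.1, midEll c δ lam q.1 q.2.1 q.2.2.2], q.2.1)

/-- **The tube point in `T³`**: `(e^{in} z₃⁻¹, e^{iλa}, z₃)`, `z₃ = e^{iℓ}`. [folklore] -/
def midT3 (n s a b : ℝ) : ThreeTorus :=
  (Circle.exp n * (Circle.exp (midEll c δ lam n s b))⁻¹, Circle.exp (lam * a), Circle.exp (midEll c δ lam n s b))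

/-- **The tube over the flat annulus** in `T³ × (base)`. [cite: GompfAGT2010, Lemma 2.2 (proof: the boundary of a tubular neighbourhood of D)] -/
def midTube (q : ℝ × ℝ × ℝ × ℝ) : ThreeTorus × ℝ := (midT3 c δ lam q.1 q.2.1 q.2.2.1 q.2.2.2, q.2.1)

variable {c δ lam}

/-- The tube is `expT` of its real form. [folklore] -/
theorem midTube_eq (q : ℝ × ℝ × ℝ × ℝ) :
    midTube c δ lam q = (expT (midReal c δ lam q).1, (midReal c δ lam q).2) := by
  simp only [midTube, midT3, midReal, expT]
  refine Prod.ext (Prod.ext ?_ (Prod.ext ?_ ?_)) rfl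
  · simp only [Matrix.cons_val_zero]
    rw [sub_eq_add_neg, Circle.exp_add, Circle.exp_neg]
  · simp
  · simp

/-- Smoothness of the fibre angle where `σ₀` is smooth. [folklore] -/
theorem contDiffAt_midEll {q : ℝ × ℝ × ℝ}
    (hσ : ContDiffAt ℝ ∞ (fun p : ℝ × ℝ ↦ sigmaFar c δ (Circle.exp p.1) p.2) (q.1, q.2.1)) :
    ContDiffAt ℝ ∞ (fun q : ℝ × ℝ × ℝ ↦ midEll c δ lam q.1 q.2.1 q.2.2) q := by
  unfold midEll
  have h1 : ContDiffAt ℝ ∞ (fun q : ℝ × ℝ × ℝ ↦ sigmaFar c δ (Circle.exp q.1) q.2.1) q :=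
    hσ.comp q (contDiffAt_fst.prodMk (contDiffAt_fst.comp q contDiffAt_snd))
  exact h1.sub (contDiffAt_const.mul (contDiffAt_snd.comp q contDiffAt_snd))

/-- **Smoothness of the real form** where `σ₀` is smooth. [folklore] -/
theorem contDiffAt_midReal {q : ℝ × ℝ × ℝ × ℝ}
    (hσ : ContDiffAt ℝ ∞ (fun p : ℝ × ℝ ↦ sigmaFar c δ (Circle.exp p.1) p.2) (q.1, q.2.1)) :
    ContDiffAt ℝ ∞ (midReal c δ lam) q := by
  have hℓ : ContDiffAt ℝ ∞ (fun q : ℝ × ℝ × ℝ × ℝ ↦ midEll c δ lam q.1 q.2.1 q.2.2.2) q := by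
    have hp : ContDiffAt ℝ ∞ (fun q : ℝ × ℝ × ℝ × ℝ ↦ (q.1, q.2.1, q.2.2.2)) q :=
      (contDiff_fst.prodMk ((contDiff_fst.comp contDiff_snd).prodMk
        (contDiff_snd.comp (contDiff_snd.comp contDiff_snd)))).contDiffAt
    exact (contDiffAt_midEll (lam := lam) (q := (q.1, q.2.1, q.2.2.2)) hσ).comp q hp
  unfold midReal
  refine ContDiffAt.prodMk ?_ (contDiffAt_fst.comp q contDiffAt_snd)
  rw [contDiffAt_piLp]
  intro j
  fin_cases j
  · exact contDiffAt_fst.sub hℓ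
  · exact contDiffAt_const.mul (contDiff_fst.comp (contDiff_snd.comp contDiff_snd)).contDiffAt
  · exact hℓ

/-- **Injectivity of the tube** (modulo `2π` in the angle `n`): for `0 < λ`, `|λa|, |λa'| < π` and
`|λb - λb'| < 2π`. [folklore] -/
theorem midTube_inj (hlam : 0 < lam) {n n' s s' a a' b b' : ℝ}
    (ha : |lam * a| < π) (ha' : |lam * a'| < π) (hbb : |lam * b - lam * b'| < 2 * π)
    (h : midTube c δ lam (n, s, a, b) = midTube c δ lam (n', s', a', b')) :
    Circle.exp n = Circle.exp n' ∧ s = s' ∧ a = a' ∧ b = b' := by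
  simp only [midTube, midT3, Prod.mk.injEq] at h
  obtain ⟨⟨h1, h2, h3⟩, hs⟩ := h
  subst hs
  have hn : Circle.exp n = Circle.exp n' := by
    have := congrArg (fun z : Circle ↦ z * Circle.exp (midEll c δ lam n s b)) h1
    simp only [inv_mul_cancel_right] at this
    rw [h3] at this
    simpa using this
  have hA : a = a' := by
    have e1 := Circle.arg_exp (x := lam * a) (by linarith [(abs_lt.1 ha).1]) (abs_lt.1 ha).2.le
    have e2 := Circle.arg_exp (x := lam * a') (by linarith [(abs_lt.1 ha').1]) (abs_lt.1 ha').2.le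
    have : lam * a = lam * a' := by rw [← e1, ← e2, h2]
    exact mul_left_cancel₀ hlam.ne' this
  have hσ : sigmaFar c δ (Circle.exp n) s = sigmaFar c δ (Circle.exp n') s := by rw [hn]
  have hB : b = b' := by
    have e' : Circle.exp (lam * b' - lam * b) = 1 := by
      have := congrArg (fun z ↦ z * (Circle.exp (midEll c δ lam n' s b'))⁻¹) h3
      rw [mul_inv_cancel, ← Circle.exp_neg, ← Circle.exp_add] at this
      rw [← this, midEll, midEll, hσ]
      congr 1; ring
    obtain ⟨k, hk⟩ := Circle.exp_eq_one.1 e'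
    have hk0 : (k : ℝ) = 0 := by
      have habs : |(k : ℝ) * (2 * π)| < 2 * π := by rw [← hk, abs_sub_comm]; exact hbb
      rw [abs_mul, abs_of_pos (by positivity : (0 : ℝ) < 2 * π)] at habs
      have h1' : |(k : ℝ)| < 1 := by nlinarith [Real.pi_pos, abs_nonneg (k : ℝ)]
      have : |k| < 1 := by exact_mod_cast h1'
      have : k = 0 := Int.abs_lt_one_iff.mp this
      simp [this]
    have : lam * b' - lam * b = 0 := by rw [hk, hk0, zero_mul]
    have : lam * b = lam * b' := by linarith
    exact mul_left_cancel₀ hlam.ne' this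
  exact ⟨hn, rfl, hA, hB⟩

/-- The reordering `(n, s, a, b) ↦ ((n, s), (a, b))`, a diffeomorphism. [folklore] -/
def midIn : (ℝ × ℝ × ℝ × ℝ) ≃ₘ⟮𝓘(ℝ, ℝ × ℝ × ℝ × ℝ), 𝓘(ℝ, (ℝ × ℝ) × (ℝ × ℝ))⟯ ((ℝ × ℝ) × (ℝ × ℝ)) where
  toFun q := ((q.1, q.2.1), (q.2.2.1, q.2.2.2))
  invFun p := (p.1.1, p.1.2, p.2.1, p.2.2)
  left_inv q := by simp
  right_inv p := by simp
  contMDiff_toFun := by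
    refine contMDiff_iff_contDiff.2 ?_
    have h1 : ContDiff ℝ ∞ fun q : ℝ × ℝ × ℝ × ℝ ↦ q.1 := contDiff_fst
    have h2 : ContDiff ℝ ∞ fun q : ℝ × ℝ × ℝ × ℝ ↦ q.2.1 := contDiff_fst.comp contDiff_snd
    have h3 : ContDiff ℝ ∞ fun q : ℝ × ℝ × ℝ × ℝ ↦ q.2.2.1 := contDiff_fst.comp (contDiff_snd.comp contDiff_snd)
    have h4 : ContDiff ℝ ∞ fun q : ℝ × ℝ × ℝ × ℝ ↦ q.2.2.2 := contDiff_snd.comp (contDiff_snd.comp contDiff_snd)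
    exact (h1.prodMk h2).prodMk (h3.prodMk h4)
  contMDiff_invFun := by
    refine contMDiff_iff_contDiff.2 ?_
    have h1 : ContDiff ℝ ∞ fun p : (ℝ × ℝ) × (ℝ × ℝ) ↦ p.1.1 := contDiff_fst.comp contDiff_fst
    have h2 : ContDiff ℝ ∞ fun p : (ℝ × ℝ) × (ℝ × ℝ) ↦ p.1.2 := contDiff_snd.comp contDiff_fst
    have h3 : ContDiff ℝ ∞ fun p : (ℝ × ℝ) × (ℝ × ℝ) ↦ p.2.1 := contDiff_fst.comp contDiff_snd
    have h4 : ContDiff ℝ ∞ fun p : (ℝ × ℝ) × (ℝ × ℝ) ↦ p.2.2 := contDiff_snd.comp contDiff_snd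
    exact h1.prodMk (h2.prodMk (h3.prodMk h4))

/-- The value of `midIn`. [folklore] -/
@[simp] theorem midIn_apply (q : ℝ × ℝ × ℝ × ℝ) : midIn q = ((q.1, q.2.1), (q.2.2.1, q.2.2.2)) := rfl

/-- The real form factors: `midReal = northAssemble ∘ (graph of the shear) ∘ midIn`. [folklore] -/
theorem midReal_eq (q : ℝ × ℝ × ℝ × ℝ) :
    midReal c δ lam q = northAssemble ((midIn q).1,
      (lam * (midIn q).2.1, sigmaFar c δ (Circle.exp (midIn q).1.1) (midIn q).1.2 - lam * (midIn q).2.2)) := by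
  simp only [midReal, midEll, northAssemble_apply, midIn_apply]

/-- **The real form is a local diffeomorphism** where `σ₀` is smooth (for `λ ≠ 0`). [folklore] -/
theorem isLocalDiffeomorphAt_midReal (hlam : lam ≠ 0) {q : ℝ × ℝ × ℝ × ℝ}
    (hσ : ∀ᶠ p in 𝓝 (q.1, q.2.1), ContDiffAt ℝ ∞ (fun p : ℝ × ℝ ↦ sigmaFar c δ (Circle.exp p.1) p.2) p) :
    IsLocalDiffeomorphAt 𝓘(ℝ, ℝ × ℝ × ℝ × ℝ) 𝓘(ℝ, (𝔼 3) × ℝ) ∞ (midReal c δ lam) q := by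
  obtain ⟨U, hU, hUo, hqU⟩ : ∃ U : Set (ℝ × ℝ),
      (∀ p ∈ U, ContDiffAt ℝ ∞ (fun p : ℝ × ℝ ↦ sigmaFar c δ (Circle.exp p.1) p.2) p) ∧ IsOpen U ∧ (q.1, q.2.1) ∈ U := by
    obtain ⟨U, hU, hUo, hq⟩ := mem_nhds_iff.1 hσ
    exact ⟨U, fun p hp ↦ hU hp, hUo, hq⟩
  have h1 : IsLocalDiffeomorphAt 𝓘(ℝ, ℝ × ℝ × ℝ × ℝ) 𝓘(ℝ, (ℝ × ℝ) × (ℝ × ℝ)) ∞ midIn q :=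
    midIn.isLocalDiffeomorph q
  have h2 : IsLocalDiffeomorphAt 𝓘(ℝ, (ℝ × ℝ) × (ℝ × ℝ)) 𝓘(ℝ, (ℝ × ℝ) × (ℝ × ℝ)) ∞
      (fun p : (ℝ × ℝ) × (ℝ × ℝ) ↦ (p.1, (lam * p.2.1, sigmaFar c δ (Circle.exp p.1.1) p.1.2 - lam * p.2.2)))
      (midIn q) := by
    set W : Set ((ℝ × ℝ) × (ℝ × ℝ)) := {p | p.1 ∈ U} with hW
    have hWo : IsOpen W := hUo.preimage continuous_fst
    have hqW : midIn q ∈ W := hqU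
    have hf : ContDiffOn ℝ ∞ (fun p : (ℝ × ℝ) × (ℝ × ℝ) ↦
        (lam * p.2.1, sigmaFar c δ (Circle.exp p.1.1) p.1.2 - lam * p.2.2)) W := by
      intro p hp
      have hσ' : ContDiffAt ℝ ∞ (fun p : (ℝ × ℝ) × (ℝ × ℝ) ↦ sigmaFar c δ (Circle.exp p.1.1) p.1.2) p :=
        (hU _ hp).comp p contDiffAt_fst
      exact ((contDiffAt_const.mul (contDiffAt_fst.comp p contDiffAt_snd)).prodMk
        (hσ'.sub (contDiffAt_const.mul (contDiffAt_snd.comp p contDiffAt_snd)))).contDiffWithinAt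
    refine isLocalDiffeomorphAt_graph hWo hqW hf (by exact_mod_cast le_top)
      (pair2EquivProd (lam, 0) (0, -lam) (by simp [hlam])) ?_
    set p₀ := midIn q
    have hu : HasDerivAt (fun a ↦ (lam * a, sigmaFar c δ (Circle.exp p₀.1.1) p₀.1.2 - lam * p₀.2.2)) (lam, 0) p₀.2.1 := by
      refine HasDerivAt.prodMk ?_ (hasDerivAt_const _ _)
      simpa using (hasDerivAt_id p₀.2.1).const_mul lam
    have hv : HasDerivAt (fun b ↦ (lam * p₀.2.1, sigmaFar c δ (Circle.exp p₀.1.1) p₀.1.2 - lam * b)) (0, -lam) p₀.2.2 := by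
      refine (hasDerivAt_const _ _).prodMk ?_
      simpa using ((hasDerivAt_id p₀.2.2).const_mul lam).const_sub (sigmaFar c δ (Circle.exp p₀.1.1) p₀.1.2)
    have hdiff : DifferentiableAt ℝ
        (fun x : ℝ × ℝ ↦ (lam * x.1, sigmaFar c δ (Circle.exp p₀.1.1) p₀.1.2 - lam * x.2)) p₀.2 :=
      ((differentiableAt_const _).mul differentiableAt_fst).prodMk
        ((differentiableAt_const _).sub ((differentiableAt_const _).mul differentiableAt_snd))
    have h := hasFDerivAt_of_partials hdiff hu hv
    rw [coe_pair2EquivProd]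
    exact h
  have h3 := northAssemble.isLocalDiffeomorph ((midIn q).1,
      (lam * (midIn q).2.1, sigmaFar c δ (Circle.exp (midIn q).1.1) (midIn q).1.2 - lam * (midIn q).2.2))
  have h := (h1.comp (K := 𝓘(ℝ, (ℝ × ℝ) × (ℝ × ℝ))) (P := (ℝ × ℝ) × (ℝ × ℝ)) h2).comp
    (K := 𝓘(ℝ, (𝔼 3) × ℝ)) (P := (𝔼 3) × ℝ) h3
  exact isLocalDiffeomorphAt_congr_nhds' h (Filter.Eventually.of_forall fun q' ↦ midReal_eq q')

variable (ψ : ThreeTorus ≃ₘ⟮𝓣, 𝓣⟯ ThreeTorus)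

/-- **The tube over the flat annulus, read in the mapping torus, is a local diffeomorphism** at
points with `0 < s < 3/2` where `σ₀` is smooth (for `λ ≠ 0`). [folklore] -/
theorem isLocalDiffeomorphAt_mtPt_midTube (hlam : lam ≠ 0) {q : ℝ × ℝ × ℝ × ℝ} (h0 : 0 < q.2.1)
    (h1 : q.2.1 < 3 / 2)
    (hσ : ∀ᶠ p in 𝓝 (q.1, q.2.1), ContDiffAt ℝ ∞ (fun p : ℝ × ℝ ↦ sigmaFar c δ (Circle.exp p.1) p.2) p) :
    IsLocalDiffeomorphAt 𝓘(ℝ, ℝ × ℝ × ℝ × ℝ) 𝓘(ℝ, 𝔼 4) ∞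
      (fun q : ℝ × ℝ × ℝ × ℝ ↦ mtPt ψ (midTube c δ lam q).1 (midTube c δ lam q).2) q := by
  have hR := isLocalDiffeomorphAt_midReal hlam hσ
  have hC : IsLocalDiffeomorphAt 𝓘(ℝ, (𝔼 3) × ℝ) 𝓘(ℝ, 𝔼 4) ∞ (mtCoord ψ) (midReal c δ lam q) := by
    have h := isLocalDiffeomorphAt_mtCoord (ψ := ψ) (q := midReal c δ lam q) h0 h1
    rw [← modelWithCornersSelf_prod, chartedSpaceSelf_prod] at h
    exact h
  have h := hR.comp (K := 𝓘(ℝ, 𝔼 4)) (P := MTorus ψ) hC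
  refine isLocalDiffeomorphAt_congr_nhds' h (Filter.Eventually.of_forall fun q' ↦ ?_)
  show mtPt ψ _ _ = mtCoord ψ (midReal c δ lam q')
  rw [midTube_eq, mtCoord]

/-- **Equivariance under the tube shear** (the seam condition): for `-π < c < 1`, `0 < δ`,
`s ≤ 3/4 - δ` and `3/4 + δ ≤ s + 1`, `tubeShear (midT3 n s a b) = midT3 n (s + 1) a b`. [cite: GompfAGT2010, Thm 2.1 (proof: F′ closes up in X_φ through the monodromy)] -/
theorem tubeShear_midT3 (hc1 : -π < c) (hc2 : c < 1) (hδ : 0 < δ) {s : ℝ} (hs : s ≤ 3 / 4 - δ)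
    (hs1 : 3 / 4 + δ ≤ s + 1) (n a b : ℝ) :
    tubeShear (midT3 c δ lam n s a b) = midT3 c δ lam n (s + 1) a b := by
  have hσ0 : sigmaFar c δ (Circle.exp n) s = 0 := sigmaFar_of_le hδ hs
  have hσ1 : sigmaFar c δ (Circle.exp n) (s + 1) = seamLift c (Circle.exp n) := sigmaFar_of_ge hδ hs1
  have hℓ0 : midEll c δ lam n s b = -(lam * b) := by rw [midEll, hσ0, zero_sub]
  have hℓ1 : midEll c δ lam n (s + 1) b = seamLift c (Circle.exp n) + -(lam * b) := by
    rw [midEll, hσ1, sub_eq_add_neg]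
  have hF : shearF (Circle.exp n) = Circle.exp (seamLift c (Circle.exp n)) := by
    rw [shearF_eq_mul_shearFactor, circleExp_seamLift hc1 hc2]
  have hprod : (midT3 c δ lam n s a b).1 * (midT3 c δ lam n s a b).2.2 = Circle.exp n := by
    simp [midT3]
  rw [tubeShear, hprod, hF]
  simp only [midT3, hℓ0, hℓ1, Circle.exp_add]
  refine Prod.ext ?_ (Prod.ext rfl ?_)
  · show Circle.exp n * (Circle.exp (-(lam * b)))⁻¹ * (Circle.exp (seamLift c (Circle.exp n)))⁻¹ =
      Circle.exp n * (Circle.exp (seamLift c (Circle.exp n)) * Circle.exp (-(lam * b)))⁻¹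
    rw [mul_inv, mul_assoc, mul_comm ((Circle.exp (-(lam * b)))⁻¹)]
  · show Circle.exp (-(lam * b)) * Circle.exp (seamLift c (Circle.exp n)) =
      Circle.exp (seamLift c (Circle.exp n)) * Circle.exp (-(lam * b))
    rw [mul_comm]

end Mid

end Literature.Topology.FourManifolds
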